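import Summits.HodgeConjecture.HodgeConjecture.Theorems.F0P5CurveThetaCompanionRelabelOfLocalFactors
import Summits.HodgeConjecture.HodgeConjecture.Theorems.F0LD2LocalTypesOfEquivAnyRank
import Literature.NumberTheory.Automorphic.Liu2021.Def411WeilCarriersIrreducibleOrZeroAtLine
import Literature.NumberTheory.GelbartRogawski1991.ChiSplittingLocalFactors
import HarnessLib

/-!
# LD2 organ U₂′ pay-down, E₂ stage A — at rank 2, an equivalence of NON-ZERO θ-carriers `ω(λ, ε_a, χ)_f ≃ ω(λ, ε_{a′}, χ′)_f` restricts at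
# EVERY finite place to an equivalence of the IRREDUCIBLE local types `Θ_v(λ, a, χ) ≃ Θ_v(λ, a′, χ′)` (the restriction step of
# [Liu2021, Thm. 4.18 (2)]'s proof «follows from Lemma D.1», l. 2270, for the unitary Shimura CURVES)

Cell `hodgecm-mathlib`, half A line LD2 (socket 27458 `stub_S1b_facts`; organ U₂′ `TwoTriples₂` of LD2-plan (g0)'s skeleton — its same-λ half E₂ is the
hypothesis `hE` of ★ `F0LD2LineClassOfEquiv.lineClassRigidity₂_of_equivForces`) and line LD1 ((P♯) line pin); seat LD2-p01 (g0), 2026-09-02.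
THEOREMS ONLY (no definition, no `sorry`, no instance, no notation); `--supports stmt-HodgeConjecture-24832`.

WHAT (all inputs ★, NO letter): for the rank-2 CM θ-packages `𝓢_{λ,a} = congrW … (undoubledSplittings … (toHeckeCharacter L λ) (borelPlaceMeasure L)
(cmFinLocalFamily …))` of [Liu2021, App. D §D.1]:
* `isIrreducible_localType₂` — if the global carrier `ω(λ, ε_a, χ)_f` (★ `omegaAtLine …`) is NON-ZERO, the local type
  `Θ_v(λ, a, χ) = Coinv(ω_v ∘ (u ↦ u·1₂), χ_v) ∘ (k ↦ k ⊗ 1)` of `U(diag dV)(L⁺_v)` is IRREDUCIBLE at every finite `v`: non-zero by ★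
  `F0P5CurveThetaCompanionRelabelOfLocalFactors.nontrivial_localCoinv_of_nontrivial_omegaAtLine` (⊗′ structure, [Flath1979]), irreducible-or-zero by
  ★ `isIrreducibleOrZero_and_isAdmissible_local (2 ≤ n)` ([MVW IV.4] ★ non-split, [Zelevinsky1980] ★ split, unitarity ★
  `isL2Isometric_omegaLoc_congrW_undoubledSplittings_cmFinLocalFamily`), pulled back along the onto `localLineInl` (★ `localLineInl_surjective`).
* `nonempty_equiv_localTypes₂` — a `U(diag dV)(𝔸_{L⁺,f})`-equivariant linear equivalence `ω(λ, ε_a, χ)_f ≃ ω(λ, ε_{a′}, χ′)_f` of a non-zero carrier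
  (the `hst` shape of ★ `locF_eq_of_equiv_of_lemD1AsPrintedAtV`, produced from two θ-labels of one `σ` by ★
  `F0LD2LineClassOfEquiv.exists_linearEquiv_rhoVAtLine_of_injective_pair`) gives, at EVERY finite `v`, an equivalence of local types
  `Θ_v(λ, a, χ) ≃ Θ_v(λ, a′, χ′)` — ★ `nonempty_equivId_of_equiv` + the rank-free restriction step ★
  `F0LD2LocalTypesOfEquivAnyRank.nonempty_equiv_localTypes_of_equivId_of_isIrreducible_of_one_le` ([FlathCorvallis1979, Thm. 3] uniqueness) with
  `hfac` = ★ `pairSmall₁_chiSplittingLine_finPairToAdelic_eq_localRefSection`.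
Stage B (separate file) reads [Liu2021, Lem. D.1 (4)] on these local equivalences to get the line class `locF a v = locF a′ v`.

HONEST LABEL.  HC_CM is proved only modulo the 7 printed citations (2 remaining: hLiu418 = stmt-HodgeConjecture-24832, h413 =
stmt-HodgeConjecture-24833) until rung 0 closes; this file discharges none of them.

## References
* [Liu2021] Y. Liu, Camb. J. Math. 9 (2021) = arXiv:2102.11518: Def. 4.11 (l. 2092–2096), Thm. 4.18 (2) and proof (l. 2270), App. D §D.1, Lem. D.1.
* [FlathCorvallis1979] D. Flath, PSPM 33.1 (1979), Thm. 3; §2 Example 2.  [MVW1987] Mœglin–Vignéras–Waldspurger, LNM 1291, Ch. 3 IV.4.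
* [Zelevinsky1980] A. Zelevinsky, Ann. Sci. ÉNS 13 (1980), Thm. 4.2.
-/

set_option autoImplicit false
set_option linter.dupNamespace false

noncomputable section

open scoped Matrix Kronecker RestrictedProduct NumberField TensorProduct
open NumberField IsDedekindDomain Filter
open Literature.NumberTheory Literature.NumberTheory.Automorphic Literature.NumberTheory.Automorphic.UnitaryGroup
open Literature.NumberTheory.GelbartRogawski1991 Literature.NumberTheory.GelbartRogawski1991.UnitaryDualPair
open Literature.NumberTheory.GelbartRogawski1991.UnitaryDualPair.WeilCoinv
open Literature.NumberTheory.GelbartRogawski1991.UnitaryDualPair.LocalSplitting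
open Literature.NumberTheory.GelbartRogawski1991.GRConstruction
open Literature.NumberTheory.Weil1964 Literature.RepresentationTheory
open Literature.RepresentationTheory.HeisenbergGroup
open Literature.NumberTheory.GaloisRepresentations Literature.RepresentationTheory.HarrisKudlaSweet1996
open Literature.NumberTheory.Automorphic.IdeleClassGroup Literature.RepresentationTheory.Liu2021
open Literature.NumberTheory.Automorphic.Liu2021 Literature.NumberTheory.Automorphic.Liu2021.Def411WeilCarriers
open Literature.NumberTheory.Automorphic.Liu2021.Def411WeilCarriersDoubling
open Summit.HodgeConjecture.HodgeConjecture.Cruxes.HLiu418.F0P5CurveThetaCompanionRelabelOfLocalFactors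
open Summit.HodgeConjecture.HodgeConjecture.Cruxes.HLiu418.F0LD2LocalTypesOfEquivAnyRank

namespace Summit.HodgeConjecture.HodgeConjecture.Cruxes.HLiu418.F0LD2LocalTypesRankTwo

variable (L : Type) [Field L] [NumberField L] [IsCMField L]
  {n' : ℕ} (e₁ : Fin 2 × Fin 1 ≃ Fin n') (dV : Fin 2 → L) (hdV : ∀ i, IsCMField.complexConj L (dV i) = dV i) (hdV0 : ∀ i, dV i ≠ 0)
  (lam : Literature.NumberTheory.Automorphic.IdeleClassGroup L →ₜ* Circle) (hlam : IsConjugateSymplectic L lam)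
  (a a' : (Fp L)ˣ) (χ χ' : Chi (Fp L) L (IsCMField.complexConj L)) (v : HeightOneSpectrum (𝓞 (Fp L)))

/-! ## §1 The local types of a NON-ZERO rank-2 θ-carrier are irreducible -/

set_option maxHeartbeats 1600000 in -- the CM θ-package terms (cf. ★ `F0P2sNodeBPrimeHolds`, same class of statements)
/-- **The local type `Θ_v(λ, a, χ)` of a NON-ZERO rank-2 carrier `ω(λ, ε_a, χ)_f` is IRREDUCIBLE** at every finite place `v` of `L⁺`
(non-zero: ★ `nontrivial_localCoinv_of_nontrivial_omegaAtLine`; irreducible-or-zero: ★ `isIrreducibleOrZero_and_isAdmissible_local (2 ≤ n)`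
with the unitarity ★ `isL2Isometric_omegaLoc_congrW_undoubledSplittings_cmFinLocalFamily`; pulled back along the onto `localLineInl`).
[cite: Liu2021, App. D Lem. D.1 first sentence (l. 5227), Def. 4.11 (l. 2092–2096)] [cite: FlathCorvallis1979, §2 Example 2] -/
theorem isIrreducible_localType₂
    [Nontrivial (omegaAtLine (Fp L) L (IsCMField.complexConj L) 2 e₁ (Matrix.diagonal dV) (complexConj_imagUnit L) (imagUnit_ne_zero L) (imagUnit_mul_self L) (realDiagonal_isSymm L dV hdV) (isUnit_det_realDiagonal L dV hdV hdV0) (realDiagonal_map L dV hdV).symm (fun b => isCompatible_chiSplittingLine L e₁ dV hdV hdV0 (toHeckeCharacter L lam) (isUnitary_toHeckeCharacter L lam) ((isOscillatorChar_toHeckeCharacter_iff lam).mpr hlam) (TW (Fp L) b) (isSymm_TW (Fp L) b) (isUnit_det_TW (Fp L) b) (JW (Fp L) L b) (JW_eq (Fp L) L b)) a χ)] :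
    (show Representation ℂ (localPi L (IsCMField.complexConj L) 2 (Matrix.diagonal dV) v) _ from (TwistedCoinv.rep (localCharOfCenter (Fp L) L (IsCMField.complexConj L) (JW (Fp L) L a) (JW_apply_ne_zero (Fp L) L a) χ.1 v) (((congrW L e₁ dV hdV (lineW L (TW (Fp L) a)) (complexConj_lineW L (TW (Fp L) a)) (realDiagonal_lineW L (TW (Fp L) a)) (diagonal_lineW L (TW (Fp L) a) (JW_eq (Fp L) L a)) (undoubledSplittings L e₁ dV hdV hdV0 (lineW L (TW (Fp L) a)) (complexConj_lineW L (TW (Fp L) a)) (lineW_ne_zero L (TW (Fp L) a) (isUnit_det_TW (Fp L) a)) (toHeckeCharacter L lam) (borelPlaceMeasure L) (cmFinLocalFamily L e₁ dV hdV hdV0 (lineW L (TW (Fp L) a)) (complexConj_lineW L (TW (Fp L) a)) (lineW_ne_zero L (TW (Fp L) a) (isUnit_det_TW (Fp L) a)) (toHeckeCharacter L lam) ((isOscillatorChar_toHeckeCharacter_iff lam).mpr hlam) (borelPlaceMeasure L))) (isSymm_TW (Fp L) a) (JW_eq (Fp L) L a))).omegaLoc v) (commute_omegaLoc_localCenter (Fp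 L) L (IsCMField.complexConj L) 2 e₁ (Matrix.diagonal dV) (JW (Fp L) L a) (complexConj_imagUnit L) (imagUnit_ne_zero L) (imagUnit_mul_self L) (realDiagonal_isSymm L dV hdV) (isSymm_TW (Fp L) a) (realDiagonal_map L dV hdV).symm (JW_eq (Fp L) L a) (JW_apply_ne_zero (Fp L) L a) (congrW L e₁ dV hdV (lineW L (TW (Fp L) a)) (complexConj_lineW L (TW (Fp L) a)) (realDiagonal_lineW L (TW (Fp L) a)) (diagonal_lineW L (TW (Fp L) a) (JW_eq (Fp L) L a)) (undoubledSplittings L e₁ dV hdV hdV0 (lineW L (TW (Fp L) a)) (complexConj_lineW L (TW (Fp L) a)) (lineW_ne_zero L (TW (Fp L) a) (isUnit_det_TW (Fp L) a)) (toHeckeCharacter L lam) (borelPlaceMeasure L) (cmFinLocalFamily L e₁ dV hdV hdV0 (lineW L (TW (Fp L) a)) (complexConj_lineW L (TW (Fp L) a)) (lineW_ne_zero L (TW (Fp L) a) (isUnit_det_TW (Fp L) a)) (toHeckeCharacter L lam) ((isOscillatorChar_toHeckeCharacter_iff lam).mpr hlam) (borelPlaceMeasure L))) (isSymm_TW (Fp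 L) a) (JW_eq (Fp L) L a)) v)).comp (localLineInl L (IsCMField.complexConj L) 2 e₁ (Matrix.diagonal dV) (JW (Fp L) L a) v)).IsIrreducible := by
  have hn' : 2 ≤ n' := two_le_of_finTwo_equiv e₁
  haveI : NeZero n' := ⟨by omega⟩
  -- the local central `χ_v`-quotient is non-zero (⊗′ structure of the non-zero global carrier)
  haveI hnt : Nontrivial (TwistedCoinv.Coinv (show Representation ℂ (UnitaryGroup.localPi L (IsCMField.complexConj L) 1 (JW (Fp L) L a) v) (SchwartzBruhat (Fin n' → v.adicCompletion (Fp L))) from (((congrW L e₁ dV hdV (lineW L (TW (Fp L) a)) (complexConj_lineW L (TW (Fp L) a)) (realDiagonal_lineW L (TW (Fp L) a)) (diagonal_lineW L (TW (Fp L) a) (JW_eq (Fp L) L a)) (undoubledSplittings L e₁ dV hdV hdV0 (lineW L (TW (Fp L) a)) (complexConj_lineW L (TW (Fp L) a)) (lineW_ne_zero L (TW (Fp L) a) (isUnit_det_TW (Fp L) a)) (toHeckeCharacter L lam) (borelPlaceMeasure L) (cmFinLocalFamily L e₁ dV hdV hdV0 (lineW L (TW (Fp L) a)) (complexConj_lineW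 L (TW (Fp L) a)) (lineW_ne_zero L (TW (Fp L) a) (isUnit_det_TW (Fp L) a)) (toHeckeCharacter L lam) ((isOscillatorChar_toHeckeCharacter_iff lam).mpr hlam) (borelPlaceMeasure L))) (isSymm_TW (Fp L) a) (JW_eq (Fp L) L a))).omegaLoc v).comp (localCenter L (IsCMField.complexConj L) n' (Matrix.reindex e₁ e₁ (Matrix.diagonal dV ⊗ₖ JW (Fp L) L a)) (JW (Fp L) L a) (JW_apply_ne_zero (Fp L) L a) v)) (localCharOfCenter (Fp L) L (IsCMField.complexConj L) (JW (Fp L) L a) (JW_apply_ne_zero (Fp L) L a) χ.1 v)) :=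
    nontrivial_localCoinv_of_nontrivial_omegaAtLine L e₁ dV hdV hdV0 lam hlam a χ v
  -- … and irreducible or zero ([MVW IV.4] ★ ∕ [Zelevinsky1980] ★), hence irreducible
  letI := (borelPlaceMeasure L v).mS; haveI := (borelPlaceMeasure L v).isBorel; haveI := (borelPlaceMeasure L v).isHaar
  have h0 := (isIrreducibleOrZero_and_isAdmissible_local (Fp L) L (IsCMField.complexConj L) 2 e₁ (Matrix.diagonal dV)
    (complexConj_imagUnit L) (imagUnit_ne_zero L) (imagUnit_mul_self L) (realDiagonal_isSymm L dV hdV)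
    (isUnit_det_realDiagonal L dV hdV hdV0) (realDiagonal_map L dV hdV).symm a (congrW L e₁ dV hdV (lineW L (TW (Fp L) a)) (complexConj_lineW L (TW (Fp L) a)) (realDiagonal_lineW L (TW (Fp L) a)) (diagonal_lineW L (TW (Fp L) a) (JW_eq (Fp L) L a)) (undoubledSplittings L e₁ dV hdV hdV0 (lineW L (TW (Fp L) a)) (complexConj_lineW L (TW (Fp L) a)) (lineW_ne_zero L (TW (Fp L) a) (isUnit_det_TW (Fp L) a)) (toHeckeCharacter L lam) (borelPlaceMeasure L) (cmFinLocalFamily L e₁ dV hdV hdV0 (lineW L (TW (Fp L) a)) (complexConj_lineW L (TW (Fp L) a)) (lineW_ne_zero L (TW (Fp L) a) (isUnit_det_TW (Fp L) a)) (toHeckeCharacter L lam) ((isOscillatorChar_toHeckeCharacter_iff lam).mpr hlam) (borelPlaceMeasure L))) (isSymm_TW (Fp L) a) (JW_eq (Fp L) L a)) χ.1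
    (norm_chi_eq_one (Fp L) L (IsCMField.complexConj L) (Algebra.IsQuadraticExtension.finrank_eq_two (Fp L) L)
      (UnitaryGroup.algEquiv_ne_one_of_apply_eq_neg (Fp L) L (IsCMField.complexConj L) (complexConj_imagUnit L)
        (imagUnit_ne_zero L)) χ)
    χ.2.1 v hn' (borelPlaceMeasure L v).μ fun _ =>
      isL2Isometric_omegaLoc_congrW_undoubledSplittings_cmFinLocalFamily L e₁ dV hdV hdV0 (lineW L (TW (Fp L) a))
        (complexConj_lineW L (TW (Fp L) a)) (lineW_ne_zero L (TW (Fp L) a) (isUnit_det_TW (Fp L) a)) (toHeckeCharacter L lam)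
        ((isOscillatorChar_toHeckeCharacter_iff lam).mpr hlam)
        (borelPlaceMeasure L) v (isUnitary_toHeckeCharacter L lam) (realDiagonal_lineW L (TW (Fp L) a))
        (diagonal_lineW L (TW (Fp L) a) (JW_eq (Fp L) L a)) (isSymm_TW (Fp L) a) (JW_eq (Fp L) L a) (borelPlaceMeasure L v).μ).1
  have hirr := isIrreducible_of_nontrivial h0
  exact (Representation.isIrreducible_comp_iff_of_surjective _ _
    (UnitaryGroup.localLineInl_surjective L (IsCMField.complexConj L) 2 e₁ (Matrix.diagonal dV) (JW (Fp L) L a)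
      (JW_apply_ne_zero (Fp L) L a) v)).2 hirr

/-! ## §2 Equivalent non-zero rank-2 θ-carriers have equivalent local types at every finite place -/

set_option maxHeartbeats 1600000 in -- the CM θ-package terms (cf. ★ `F0P2sNodeBPrimeHolds`)
/-- **THE RESTRICTION STEP at rank 2 for the CM θ-packages** ([Liu2021, Thm. 4.18 (2)] proof l. 2270 «follows from Lemma D.1»): a
`U(diag dV)(𝔸_{L⁺,f})`-equivariant linear equivalence `ω(λ, ε_a, χ)_f ≃ ω(λ, ε_{a′}, χ′)_f` of a NON-ZERO carrier gives, at every finite `v`, an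
equivalence of the (irreducible, §1) local types `Θ_v(λ, a, χ) ≃ Θ_v(λ, a′, χ′)` of `U(diag dV)(L⁺_v)` — ★ `nonempty_equivId_of_equiv` + ★
`nonempty_equiv_localTypes_of_equivId_of_isIrreducible_of_one_le` with `hfac` = ★ `pairSmall₁_chiSplittingLine_finPairToAdelic_eq_localRefSection`.
[cite: Liu2021, Def. 4.11 (l. 2092–2096), Thm. 4.18 (2) with proof l. 2270, App. D §D.1 Steps 1–3] [cite: FlathCorvallis1979, Theorem 3 (uniqueness clause)] -/
theorem nonempty_equiv_localTypes₂
    [Nontrivial (omegaAtLine (Fp L) L (IsCMField.complexConj L) 2 e₁ (Matrix.diagonal dV) (complexConj_imagUnit L) (imagUnit_ne_zero L) (imagUnit_mul_self L) (realDiagonal_isSymm L dV hdV) (isUnit_det_realDiagonal L dV hdV hdV0) (realDiagonal_map L dV hdV).symm (fun b => isCompatible_chiSplittingLine L e₁ dV hdV hdV0 (toHeckeCharacter L lam) (isUnitary_toHeckeCharacter L lam) ((isOscillatorChar_toHeckeCharacter_iff lam).mpr hlam) (TW (Fp L) b) (isSymm_TW (Fp L) b) (isUnit_det_TW (Fp L)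 b) (JW (Fp L) L b) (JW_eq (Fp L) L b)) a χ)]
    (hst : ∃ f : (omegaAtLine (Fp L) L (IsCMField.complexConj L) 2 e₁ (Matrix.diagonal dV) (complexConj_imagUnit L) (imagUnit_ne_zero L) (imagUnit_mul_self L) (realDiagonal_isSymm L dV hdV) (isUnit_det_realDiagonal L dV hdV hdV0) (realDiagonal_map L dV hdV).symm (fun b => isCompatible_chiSplittingLine L e₁ dV hdV hdV0 (toHeckeCharacter L lam) (isUnitary_toHeckeCharacter L lam) ((isOscillatorChar_toHeckeCharacter_iff lam).mpr hlam) (TW (Fp L) b) (isSymm_TW (Fp L) b) (isUnit_det_TW (Fp L) b) (JW (Fp L) L b) (JW_eq (Fp L) L b)) a χ) ≃ₗ[ℂ] (omegaAtLine (Fp L) L (IsCMField.complexConj L) 2 e₁ (Matrix.diagonal dV) (complexConj_imagUnit L) (imagUnit_ne_zero L) (imagUnit_mul_self L) (realDiagonal_isSymm L dV hdV) (isUnit_det_realDiagonal L dV hdV hdV0) (realDiagonal_map L dV hdV).symm (fun b => isCompatible_chiSplittingLine L e₁ dV hdV hdV0 (toHeckeCharacter L lam) (isUnitary_toHeckeCharacter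 L lam) ((isOscillatorChar_toHeckeCharacter_iff lam).mpr hlam) (TW (Fp L) b) (isSymm_TW (Fp L) b) (isUnit_det_TW (Fp L) b) (JW (Fp L) L b) (JW_eq (Fp L) L b)) a' χ'),
      ∀ (k : finAdelic (Fp L) L (IsCMField.complexConj L) 2 (Matrix.diagonal dV)) x,
        f ((rhoVAtLine (Fp L) L (IsCMField.complexConj L) 2 e₁ (Matrix.diagonal dV) (complexConj_imagUnit L) (imagUnit_ne_zero L) (imagUnit_mul_self L) (realDiagonal_isSymm L dV hdV) (isUnit_det_realDiagonal L dV hdV hdV0) (realDiagonal_map L dV hdV).symm (fun b => isCompatible_chiSplittingLine L e₁ dV hdV hdV0 (toHeckeCharacter L lam) (isUnitary_toHeckeCharacter L lam) ((isOscillatorChar_toHeckeCharacter_iff lam).mpr hlam) (TW (Fp L) b) (isSymm_TW (Fp L) b) (isUnit_det_TW (Fp L) b) (JW (Fp L) L b) (JW_eq (Fp L) L b)) a χ) k x) = (rhoVAtLine (Fp L) L (IsCMField.complexConj L) 2 e₁ (Matrix.diagonal dV) (complexConj_imagUnit L) (imagUnit_ne_zero L) (imagUnit_mul_self L) (realDiagonal_isSymm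 L dV hdV) (isUnit_det_realDiagonal L dV hdV hdV0) (realDiagonal_map L dV hdV).symm (fun b => isCompatible_chiSplittingLine L e₁ dV hdV hdV0 (toHeckeCharacter L lam) (isUnitary_toHeckeCharacter L lam) ((isOscillatorChar_toHeckeCharacter_iff lam).mpr hlam) (TW (Fp L) b) (isSymm_TW (Fp L) b) (isUnit_det_TW (Fp L) b) (JW (Fp L) L b) (JW_eq (Fp L) L b)) a' χ') k (f x)) :
    Nonempty ((show Representation ℂ (localPi L (IsCMField.complexConj L) 2 (Matrix.diagonal dV) v) _ from (TwistedCoinv.rep (localCharOfCenter (Fp L) L (IsCMField.complexConj L) (JW (Fp L) L a) (JW_apply_ne_zero (Fp L) L a) χ.1 v) (((congrW L e₁ dV hdV (lineW L (TW (Fp L) a)) (complexConj_lineW L (TW (Fp L) a)) (realDiagonal_lineW L (TW (Fp L) a)) (diagonal_lineW L (TW (Fp L) a) (JW_eq (Fp L) L a)) (undoubledSplittings L e₁ dV hdV hdV0 (lineW L (TW (Fp L) a)) (complexConj_lineW L (TW (Fp L) a)) (lineW_ne_zero L (TW (Fp L) a) (isUnit_det_TW (Fp L) a)) (toHeckeCharacter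 L lam) (borelPlaceMeasure L) (cmFinLocalFamily L e₁ dV hdV hdV0 (lineW L (TW (Fp L) a)) (complexConj_lineW L (TW (Fp L) a)) (lineW_ne_zero L (TW (Fp L) a) (isUnit_det_TW (Fp L) a)) (toHeckeCharacter L lam) ((isOscillatorChar_toHeckeCharacter_iff lam).mpr hlam) (borelPlaceMeasure L))) (isSymm_TW (Fp L) a) (JW_eq (Fp L) L a))).omegaLoc v) (commute_omegaLoc_localCenter (Fp L) L (IsCMField.complexConj L) 2 e₁ (Matrix.diagonal dV) (JW (Fp L) L a) (complexConj_imagUnit L) (imagUnit_ne_zero L) (imagUnit_mul_self L) (realDiagonal_isSymm L dV hdV) (isSymm_TW (Fp L) a) (realDiagonal_map L dV hdV).symm (JW_eq (Fp L) L a) (JW_apply_ne_zero (Fp L) L a) (congrW L e₁ dV hdV (lineW L (TW (Fp L) a)) (complexConj_lineW L (TW (Fp L) a)) (realDiagonal_lineW L (TW (Fp L) a)) (diagonal_lineW L (TW (Fp L) a) (JW_eq (Fp L) L a)) (undoubledSplittings L e₁ dV hdV hdV0 (lineW L (TW (Fp L) a)) (complexConj_lineW L (TW (Fp L) a)) (lineW_ne_zero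 L (TW (Fp L) a) (isUnit_det_TW (Fp L) a)) (toHeckeCharacter L lam) (borelPlaceMeasure L) (cmFinLocalFamily L e₁ dV hdV hdV0 (lineW L (TW (Fp L) a)) (complexConj_lineW L (TW (Fp L) a)) (lineW_ne_zero L (TW (Fp L) a) (isUnit_det_TW (Fp L) a)) (toHeckeCharacter L lam) ((isOscillatorChar_toHeckeCharacter_iff lam).mpr hlam) (borelPlaceMeasure L))) (isSymm_TW (Fp L) a) (JW_eq (Fp L) L a)) v)).comp (localLineInl L (IsCMField.complexConj L) 2 e₁ (Matrix.diagonal dV) (JW (Fp L) L a) v)).Equiv (show Representation ℂ (localPi L (IsCMField.complexConj L) 2 (Matrix.diagonal dV) v) _ from (TwistedCoinv.rep (localCharOfCenter (Fp L) L (IsCMField.complexConj L) (JW (Fp L) L a') (JW_apply_ne_zero (Fp L) L a') χ'.1 v) (((congrW L e₁ dV hdV (lineW L (TW (Fp L) a')) (complexConj_lineW L (TW (Fp L) a')) (realDiagonal_lineW L (TW (Fp L) a')) (diagonal_lineW L (TW (Fp L) a') (JW_eq (Fp L) L a')) (undoubledSplittings L e₁ dV hdV hdV0 (lineW L (TW (Fp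 L) a')) (complexConj_lineW L (TW (Fp L) a')) (lineW_ne_zero L (TW (Fp L) a') (isUnit_det_TW (Fp L) a')) (toHeckeCharacter L lam) (borelPlaceMeasure L) (cmFinLocalFamily L e₁ dV hdV hdV0 (lineW L (TW (Fp L) a')) (complexConj_lineW L (TW (Fp L) a')) (lineW_ne_zero L (TW (Fp L) a') (isUnit_det_TW (Fp L) a')) (toHeckeCharacter L lam) ((isOscillatorChar_toHeckeCharacter_iff lam).mpr hlam) (borelPlaceMeasure L))) (isSymm_TW (Fp L) a') (JW_eq (Fp L) L a'))).omegaLoc v) (commute_omegaLoc_localCenter (Fp L) L (IsCMField.complexConj L) 2 e₁ (Matrix.diagonal dV) (JW (Fp L) L a') (complexConj_imagUnit L) (imagUnit_ne_zero L) (imagUnit_mul_self L) (realDiagonal_isSymm L dV hdV) (isSymm_TW (Fp L) a') (realDiagonal_map L dV hdV).symm (JW_eq (Fp L) L a') (JW_apply_ne_zero (Fp L) L a') (congrW L e₁ dV hdV (lineW L (TW (Fp L) a')) (complexConj_lineW L (TW (Fp L) a')) (realDiagonal_lineW L (TW (Fp L) a')) (diagonal_lineW L (TW (Fp L) a') (JW_eq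 (Fp L) L a')) (undoubledSplittings L e₁ dV hdV hdV0 (lineW L (TW (Fp L) a')) (complexConj_lineW L (TW (Fp L) a')) (lineW_ne_zero L (TW (Fp L) a') (isUnit_det_TW (Fp L) a')) (toHeckeCharacter L lam) (borelPlaceMeasure L) (cmFinLocalFamily L e₁ dV hdV hdV0 (lineW L (TW (Fp L) a')) (complexConj_lineW L (TW (Fp L) a')) (lineW_ne_zero L (TW (Fp L) a') (isUnit_det_TW (Fp L) a')) (toHeckeCharacter L lam) ((isOscillatorChar_toHeckeCharacter_iff lam).mpr hlam) (borelPlaceMeasure L))) (isSymm_TW (Fp L) a') (JW_eq (Fp L) L a')) v)).comp (localLineInl L (IsCMField.complexConj L) 2 e₁ (Matrix.diagonal dV) (JW (Fp L) L a') v))) := by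
  have hn' : 2 ≤ n' := two_le_of_finTwo_equiv e₁
  haveI : NeZero n' := ⟨by omega⟩
  -- the second carrier is non-zero too (linear equivalence)
  haveI : Nontrivial (omegaAtLine (Fp L) L (IsCMField.complexConj L) 2 e₁ (Matrix.diagonal dV) (complexConj_imagUnit L) (imagUnit_ne_zero L) (imagUnit_mul_self L) (realDiagonal_isSymm L dV hdV) (isUnit_det_realDiagonal L dV hdV hdV0) (realDiagonal_map L dV hdV).symm (fun b => isCompatible_chiSplittingLine L e₁ dV hdV hdV0 (toHeckeCharacter L lam) (isUnitary_toHeckeCharacter L lam) ((isOscillatorChar_toHeckeCharacter_iff lam).mpr hlam) (TW (Fp L) b) (isSymm_TW (Fp L) b) (isUnit_det_TW (Fp L) b) (JW (Fp L) L b) (JW_eq (Fp L) L b)) a' χ') := hst.elim fun f _ => f.symm.toEquiv.nontrivial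
  -- the local types are irreducible (§1)
  haveI := isIrreducible_localType₂ L e₁ dV hdV hdV0 lam hlam a χ v
  haveI := isIrreducible_localType₂ L e₁ dV hdV hdV0 lam hlam a' χ' v
  -- read the equivalence on `U(diag dV)(𝔸_f)` itself (`ι := id`)
  refine (nonempty_equivId_of_equiv (Fp L) L (IsCMField.complexConj L) 2 e₁ (Matrix.diagonal dV) (complexConj_imagUnit L)
    (imagUnit_ne_zero L) (imagUnit_mul_self L) (realDiagonal_isSymm L dV hdV) (isUnit_det_realDiagonal L dV hdV hdV0)
    (realDiagonal_map L dV hdV).symm (fun b => isCompatible_chiSplittingLine L e₁ dV hdV hdV0 (toHeckeCharacter L lam) (isUnitary_toHeckeCharacter L lam) ((isOscillatorChar_toHeckeCharacter_iff lam).mpr hlam) (TW (Fp L) b) (isSymm_TW (Fp L) b) (isUnit_det_TW (Fp L) b) (JW (Fp L) L b) (JW_eq (Fp L) L b)) (fun b => isCompatible_chiSplittingLine L e₁ dV hdV hdV0 (toHeckeCharacter L lam) (isUnitary_toHeckeCharacter L lam) ((isOscillatorChar_toHeckeCharacter_iff lam).mpr hlam) (TW (Fp L) b) (isSymm_TW (Fp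 L) b) (isUnit_det_TW (Fp L) b) (JW (Fp L) L b) (JW_eq (Fp L) L b)) a a' χ χ' (ι := MonoidHom.id _) Function.surjective_id
    (hst.elim fun f hf => ⟨f, fun g x => hf g x⟩)).elim fun Eq => ?_
  -- restrict at `v` ([Flath1979, Thm. 3] uniqueness; rank-free ★)
  exact nonempty_equiv_localTypes_of_equivId_of_isIrreducible_of_one_le (Fp L) L (IsCMField.complexConj L) 2 e₁ (Matrix.diagonal dV)
    (complexConj_imagUnit L) (imagUnit_ne_zero L) (imagUnit_mul_self L) (realDiagonal_isSymm L dV hdV)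
    (isUnit_det_realDiagonal L dV hdV hdV0) (realDiagonal_map L dV hdV).symm (fun b => isCompatible_chiSplittingLine L e₁ dV hdV hdV0 (toHeckeCharacter L lam) (isUnitary_toHeckeCharacter L lam) ((isOscillatorChar_toHeckeCharacter_iff lam).mpr hlam) (TW (Fp L) b) (isSymm_TW (Fp L) b) (isUnit_det_TW (Fp L) b) (JW (Fp L) L b) (JW_eq (Fp L) L b)) (fun b => isCompatible_chiSplittingLine L e₁ dV hdV hdV0 (toHeckeCharacter L lam) (isUnitary_toHeckeCharacter L lam) ((isOscillatorChar_toHeckeCharacter_iff lam).mpr hlam) (TW (Fp L) b) (isSymm_TW (Fp L) b) (isUnit_det_TW (Fp L) b) (JW (Fp L) L b) (JW_eq (Fp L) L b)) a χ (congrW L e₁ dV hdV (lineW L (TW (Fp L) a)) (complexConj_lineW L (TW (Fp L) a)) (realDiagonal_lineW L (TW (Fp L) a)) (diagonal_lineW L (TW (Fp L) a) (JW_eq (Fp L) L a)) (undoubledSplittings L e₁ dV hdV hdV0 (lineW L (TW (Fp L) a)) (complexConj_lineW L (TW (Fp L) a)) (lineW_ne_zero L (TW (Fp L) a) (isUnit_det_TW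 (Fp L) a)) (toHeckeCharacter L lam) (borelPlaceMeasure L) (cmFinLocalFamily L e₁ dV hdV hdV0 (lineW L (TW (Fp L) a)) (complexConj_lineW L (TW (Fp L) a)) (lineW_ne_zero L (TW (Fp L) a) (isUnit_det_TW (Fp L) a)) (toHeckeCharacter L lam) ((isOscillatorChar_toHeckeCharacter_iff lam).mpr hlam) (borelPlaceMeasure L))) (isSymm_TW (Fp L) a) (JW_eq (Fp L) L a)) a' χ' (congrW L e₁ dV hdV (lineW L (TW (Fp L) a')) (complexConj_lineW L (TW (Fp L) a')) (realDiagonal_lineW L (TW (Fp L) a')) (diagonal_lineW L (TW (Fp L) a') (JW_eq (Fp L) L a')) (undoubledSplittings L e₁ dV hdV hdV0 (lineW L (TW (Fp L) a')) (complexConj_lineW L (TW (Fp L) a')) (lineW_ne_zero L (TW (Fp L) a') (isUnit_det_TW (Fp L) a')) (toHeckeCharacter L lam) (borelPlaceMeasure L) (cmFinLocalFamily L e₁ dV hdV hdV0 (lineW L (TW (Fp L) a')) (complexConj_lineW L (TW (Fp L) a')) (lineW_ne_zero L (TW (Fp L) a') (isUnit_det_TW (Fp L) a')) (toHeckeCharacter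 L lam) ((isOscillatorChar_toHeckeCharacter_iff lam).mpr hlam) (borelPlaceMeasure L))) (isSymm_TW (Fp L) a') (JW_eq (Fp L) L a'))
    (pairSmall₁_chiSplittingLine_finPairToAdelic_eq_localRefSection L (toHeckeCharacter L lam) (isUnitary_toHeckeCharacter L lam)
      ((isOscillatorChar_toHeckeCharacter_iff lam).mpr hlam) e₁ dV hdV hdV0 (TW (Fp L) a) (isSymm_TW (Fp L) a) (isUnit_det_TW (Fp L) a)
      (JW (Fp L) L a) (JW_eq (Fp L) L a) (borelPlaceMeasure L) (cmFinLocalFamily L e₁ dV hdV hdV0 (lineW L (TW (Fp L) a)) (complexConj_lineW L (TW (Fp L) a)) (lineW_ne_zero L (TW (Fp L) a) (isUnit_det_TW (Fp L) a)) (toHeckeCharacter L lam) ((isOscillatorChar_toHeckeCharacter_iff lam).mpr hlam) (borelPlaceMeasure L)))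
    (pairSmall₁_chiSplittingLine_finPairToAdelic_eq_localRefSection L (toHeckeCharacter L lam) (isUnitary_toHeckeCharacter L lam)
      ((isOscillatorChar_toHeckeCharacter_iff lam).mpr hlam) e₁ dV hdV hdV0 (TW (Fp L) a') (isSymm_TW (Fp L) a') (isUnit_det_TW (Fp L) a')
      (JW (Fp L) L a') (JW_eq (Fp L) L a') (borelPlaceMeasure L) (cmFinLocalFamily L e₁ dV hdV hdV0 (lineW L (TW (Fp L) a')) (complexConj_lineW L (TW (Fp L) a')) (lineW_ne_zero L (TW (Fp L) a') (isUnit_det_TW (Fp L) a')) (toHeckeCharacter L lam) ((isOscillatorChar_toHeckeCharacter_iff lam).mpr hlam) (borelPlaceMeasure L)))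
    (by omega) Eq v

end Summit.HodgeConjecture.HodgeConjecture.Cruxes.HLiu418.F0LD2LocalTypesRankTwo

end
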